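/-
Copyright (c) 2026 the pub-hodgecm-mathlib formalisation cell (harness21).  Prover seat hodgecm-mathlib-K2E3-p36 (g3), HCML Track B «K2-LIT» ∕ h413
(`stmt-HodgeConjecture-24833`), R90-TF section S3, (U3-F) assembly layer B2 §5 at the prime `2` «the DYADIC LOCAL TARGET» (captain K2E3-p17 (g11) re-deal
01:40:20Z, head token for token).  2026-09-05.
-/
import Summits.HodgeConjecture.HodgeConjecture.Theorems.R90S3LocalTarget              -- ★ B2 §5 (K2E3-p17): `one_le_valuation_of_norm_lt_one`, `coeff_zero_mul_prod_X_sub_C`, `separable_minpoly_mul_prod_X_sub_C`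
import Summits.HodgeConjecture.HodgeConjecture.Theorems.R90S3LocalPlantingDatumTwo   -- ★ B2 at p = 2 (this seat): `exists_localPlantingDatum_two`
import HarnessLib

/-!
# R90-TF · S3 · THEOREMS — `R90S3LocalTargetTwo` ((U3-F) assembly, layer B2 §5 at `p = 2`): the DYADIC LOCAL TARGET `H = minpoly(y) · ∏ (X − cᵢ)` with
# `H(0) = 2^a` EXACTLY, `r ∈ {1,2,3}` extra unit roots `cᵢ ≡ 1 (mod 4)`, degree `[K:ℚ₂] + r ≥ 3`

R90-TF section S3 (dealer R90-C12-plan (g3)); crux H413 (`stmt-HodgeConjecture-24833`, lane `--supports … --as helper`), route `HCCMUnconditional`.  The `p = 2` twin of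
★ `exists_localTarget_forall` (`R90S3LocalTarget` ED. 2): at `K = L_w` with a continuous finite `ℚ₂`-structure and `ι : K →ₐ[ℚ₂] Q̄₂`, for `m ≠ 0`, a non-zero
GENERATOR `y = m s²`, the exponent `a ≥ 1`, the number `r ∈ {1,2,3}` of extra roots with `[K:ℚ₂] + r ≥ 3`, and a monic `H ∈ ℤ₂[X]` of degree `[K:ℚ₂] + r` with
`H(0) = 2^a` EXACTLY whose image in `ℚ₂[X]` is `minpoly(y) · ∏ (X − cᵢ)` for `r` DISTINCT UNITS `cᵢ ≡ 1 (mod 4)` (roots of `H` in `ℤ₂`), separable, vanishing at `y`;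
with the low-coefficient bound on `minpoly y` that gives `‖ι y‖ < 1`.  At `p = 2` the number `r` is an OUTPUT (no chooser): ★ `exists_localPlantingDatum_two` reads
`a` and the unit part `u` off `h₀(0)` and picks `r`, `cᵢ` with `u · ∏ (−cᵢ) = 1`, i.e. `h₀(0) · ∏ (−cᵢ) = 2^a`.  Consumer: the `p = 2` FINAL of the (U3-F) assembly
(captain K2E3-p17) with ★ P8d `R90S3PlantedDyadicData`.  ★-only imports; THEOREMS ONLY (no `def`, no `instance`, no notation, no named fact, no `sorry`); never
imports `Cruxes/…/Lines`.

HONEST LABEL: HC_CM is proved only modulo the 7 printed citations (2 remaining named inputs: hLiu418 = stmt-HodgeConjecture-24832, h413 =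
stmt-HodgeConjecture-24833) until rung 0 closes; local algebra for a sub-step of a GENUINE residual ((U3-F)); proves nothing printed; count-neutral.
References: [NeukirchANT1999] Ch. II (8.2)–(8.4); [Serre1979] Ch. II §5.
-/

set_option autoImplicit false
-- the mandated namespace repeats the single-problem summit's segment (`HodgeConjecture.HodgeConjecture`)
set_option linter.dupNamespace false

noncomputable section

namespace Summit.HodgeConjecture.HodgeConjecture.R90.S3

open Polynomial IntermediateField IsDedekindDomain NumberField

section TargetTwo

variable {L : Type} [Field L] [NumberField L] (w : HeightOneSpectrum (𝓞 L))
  [Algebra ℚ_[2] (w.adicCompletion L)] [FiniteDimensional ℚ_[2] (w.adicCompletion L)]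

/-- **THE DYADIC LOCAL TARGET (B2 §5 at `p = 2`).**  At `K = L_w` with a continuous finite `ℚ₂`-structure and `ι : K →ₐ[ℚ₂] Q̄₂`, for `m ≠ 0`: a non-zero GENERATOR
`y = m s²`, an exponent `a ≥ 1`, the low-coefficient bound `‖coeffᵢ (minpoly y)‖ < 1` (`i < deg`), a number `r ∈ {1,2,3}` with `[K:ℚ₂] + r ≥ 3`, and a monic
`H ∈ ℤ₂[X]` of degree `[K:ℚ₂] + r` with `H(0) = 2^a` EXACTLY, image `minpoly(y) · ∏ (X − cᵢ)` in `ℚ₂[X]` for `r` DISTINCT UNITS `cᵢ ≡ 1 (mod 4)` that are roots of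
`H`, separable, with `H(y) = 0`.  (★ `exists_localPlantingDatum_two` + the algebra of ★ `exists_localTarget_forall`.)
[cite: NeukirchANT1999, Ch. II (8.2)-(8.4)] [cite: Serre1979, Ch. II §5] -/
theorem exists_localTarget_forall_two (hc : Continuous (algebraMap ℚ_[2] (w.adicCompletion L))) (ι : w.adicCompletion L →ₐ[ℚ_[2]] PadicAlgCl 2)
    {m : w.adicCompletion L} (hm : m ≠ 0) :
    ∃ (y s : w.adicCompletion L) (a r : ℕ) (H : ℤ_[2][X]) (c : Fin r → ℤ_[2]),
      y ≠ 0 ∧ y = m * s ^ 2 ∧ ℚ_[2]⟮y⟯ = ⊤ ∧ 1 ≤ a ∧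
      (∀ i, i < (minpoly ℚ_[2] y).natDegree → ‖(minpoly ℚ_[2] y).coeff i‖ < 1) ∧
      1 ≤ r ∧ r ≤ 3 ∧ 3 ≤ Module.finrank ℚ_[2] (w.adicCompletion L) + r ∧
      H.Monic ∧ H.natDegree = Module.finrank ℚ_[2] (w.adicCompletion L) + r ∧ H.coeff 0 = (2 : ℤ_[2]) ^ a ∧
      H.map (algebraMap ℤ_[2] ℚ_[2]) = minpoly ℚ_[2] y * ∏ i, (X - C (c i : ℚ_[2])) ∧
      (H.map (algebraMap ℤ_[2] ℚ_[2])).Separable ∧ aeval y (H.map (algebraMap ℤ_[2] ℚ_[2])) = 0 ∧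
      (∀ i, IsUnit (c i)) ∧ Function.Injective c ∧ (∀ i, (4 : ℤ_[2]) ∣ c i - 1) ∧ (∀ i, H.IsRoot (c i)) := by
  obtain ⟨y, s, h₀, r, c, hy, hys, hgen, hm₀, hdeg, hmap, hlow, hnoroot, hr1, hr3, hd3, hcu, hci, -, hc4, h00, hprod⟩ :=
    exists_localPlantingDatum_two w hc ι hm
  have hint : IsIntegral ℚ_[2] y := IsIntegral.of_finite ℚ_[2] y
  -- `a ≥ 1`
  have hd0 : 0 < h₀.natDegree := by
    rw [hdeg]; exact Module.finrank_pos
  set a : ℕ := (h₀.coeff 0).valuation with hadef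
  have ha1 : 1 ≤ a := one_le_valuation_of_norm_lt_one 2 h00 (hlow 0 hd0)
  -- the low coefficients of `minpoly y = h₀ ⊗ ℚ₂`
  have hdegm : (minpoly ℚ_[2] y).natDegree = h₀.natDegree := by
    rw [← hmap, hm₀.natDegree_map]
  have hlow' : ∀ i, i < (minpoly ℚ_[2] y).natDegree → ‖(minpoly ℚ_[2] y).coeff i‖ < 1 := by
    intro i hi
    rw [← hmap, coeff_map, PadicInt.algebraMap_apply, PadicInt.padic_norm_e_of_padicInt]
    exact hlow i (hdegm ▸ hi)
  -- the target
  set H : ℤ_[2][X] := h₀ * ∏ i, (X - C (c i)) with hHdef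
  have hprodm : (∏ i : Fin r, (X - C (c i))).Monic := monic_prod_of_monic _ _ fun i _ => monic_X_sub_C (c i)
  have hHm : H.Monic := hm₀.mul hprodm
  have hHdeg : H.natDegree = Module.finrank ℚ_[2] (w.adicCompletion L) + r := by
    rw [hHdef, hm₀.natDegree_mul hprodm, hdeg, natDegree_prod_of_monic _ _ fun i _ => monic_X_sub_C (c i)]
    simp
  have hH0 : H.coeff 0 = (2 : ℤ_[2]) ^ a := by
    rw [hHdef, coeff_zero_mul_prod_X_sub_C, hprod]
  have hHmap : H.map (algebraMap ℤ_[2] ℚ_[2]) = minpoly ℚ_[2] y * ∏ i, (X - C (c i : ℚ_[2])) := by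
    rw [hHdef, Polynomial.map_mul, hmap, Polynomial.map_prod]
    simp [PadicInt.algebraMap_apply]
  -- roots of the unit centres (in `ℤ₂` and in `ℚ₂`) and separability
  have hci' : Function.Injective fun i => (c i : ℚ_[2]) := fun i j h => hci (Subtype.val_injective h)
  have hroot' : ∀ i, ¬ (minpoly ℚ_[2] y).IsRoot (c i : ℚ_[2]) := by
    intro i hri
    apply hnoroot (c i) (hcu i)
    rw [← hmap, ← PadicInt.algebraMap_apply, isRoot_map_iff (IsFractionRing.injective ℤ_[2] ℚ_[2])] at hri
    exact hri
  have hsep : (H.map (algebraMap ℤ_[2] ℚ_[2])).Separable := by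
    rw [hHmap]; exact separable_minpoly_mul_prod_X_sub_C hint (fun i => (c i : ℚ_[2])) hci' hroot'
  have haeval : aeval y (H.map (algebraMap ℤ_[2] ℚ_[2])) = 0 := by
    rw [hHmap, map_mul, minpoly.aeval, zero_mul]
  have hrootsZ : ∀ i, H.IsRoot (c i) := by
    intro i
    rw [hHdef, IsRoot, eval_mul, eval_prod, Finset.prod_eq_zero (Finset.mem_univ i) (by simp), mul_zero]
  refine ⟨y, s, a, r, H, c, hy, hys, hgen, ha1, hlow', hr1, hr3, ?_, hHm, hHdeg, hH0, hHmap, hsep, haeval, hcu, hci, hc4, hrootsZ⟩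
  rw [← hdeg]; exact hd3

end TargetTwo

end Summit.HodgeConjecture.HodgeConjecture.R90.S3

end
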